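import Mathlib
import Summits.PneNP.PneNP.Theorems.SoloBlindStreamingSimulation
import HarnessLib

/-!
# THEOREM D♯: one universal polynomial simulates every uniform streaming algorithm

(Solo seat `solo-PneNP-blind`; sequel to `SoloBlindStreamingSimulation` (THEOREM D,
`USTREAM S T ⊆ P`).)

THEOREM D proved `USTREAM S T ⊆ P` for polynomially bounded `S, T` by simulating the stream, with
the simulating machine's polynomial hidden behind the algorithm (`∀ A, ∃ M p, …`). The polynomial
of that construction in fact depends only on the tree's four fixed code stages (`USim.cf_pre`,
`cf_ra`, `cf_rb`, `cf_post`), not on the algorithm. This file records the construction with the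
quantifiers in the honest order:

* `USim.exists_loopPoly`, `USim.exists_deciderPoly` — ONE polynomial `p`, fixed once and for all,
  such that EVERY uniform streaming algorithm with empty initial states, space `S` and
  update/report time `T` is one `TM2` machine running within `p(N + S N' + T N' + T N)`
  (`N' = max N 1`). (Same machines and the same proof text as `USim.exists_loopMachine` /
  `USim.exists_streamDecider`; only the existential polynomial is moved in front of the algorithm.)
* `exists_USTREAM_subset_DTIME_pow` — **THEOREM D♯**: for every `k` there is ONE exponent `d` with
  `USTREAM S T ⊆ DTIME(nᵈ)` for all `S, T ≤ Nᵏ + k`. The degree is universal but inexplicit (it is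
  read off `p` by `exists_eval_le_mul_pow_add`); an explicit degree would require tracking the
  polynomials of the code-stage calculus, which the tree keeps existential.

Use (sequel `SoloBlindSparseHierarchyStream`): with the sparse time hierarchy inside `P`
(`SoloBlindSparseHierarchy.exists_sparse_mem_P_not_mem_DTIME_pow`) THEOREM D♯ gives, for every
`k`, a SPARSE `L ∈ P` outside `USTREAM (Nᵏ+k) (Nᵏ+k)` — every level of the family whose
`SAT`-instance calibrates the summit (THEOREM E) is unconditionally separated from `P`.
References: D. M. McKay, C. D. Murray, R. R. Williams, *Weak lower bounds on resource-bounded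
compression imply strong separations of complexity classes*, STOC 2019, §2 [bib:
McKayMurrayWilliams2019]; S. Arora, B. Barak, *Computational Complexity* (2009), §1.3–1.4 and
Def. 1.12–1.13 [bib: AroraBarakCC2009].
-/

namespace Summit.PneNP.PneNP.Theorems.SoloBlind

open Computability Polynomial
open Literature.Computability.Complexity
open Literature.Computability.Complexity.CodeFP (natE unE bitE pairE strE pairE_apply
  unE_eq_ones length_unE length_natE_le)
open Literature.Computability.MetaComplexity
open Literature.Computability.MetaComplexity.McKayMurrayWilliams2019

namespace USim

/-! ### The simulation of THEOREM D with a universal polynomial -/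

/-- **The loop machine, universal polynomial.** There is ONE polynomial `q` such that for EVERY
streaming algorithm `A` running in space `S` with a uniform update machine `MU` of time `T`, the
`while` machine of `exists_loopMachine` maps the initial loop word of a nonempty effective input
`v` to the final one within `q(|v| + S |v| + T |v| + |bin |v|| + |bin N|)` steps. (Proof text of
`exists_loopMachine`; `q` is built from the code stages `cf_ra`, `cf_rb` only.)
[cite: AroraBarak2009, §1.3–1.4 (composition; running a machine in a loop; subroutine on a field)] -/
theorem exists_loopPoly : ∃ q : Polynomial ℕ, ∀ (A : StreamingAlgorithm) (S T : ℕ → ℕ),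
    RunsInSpace A S → ∀ (MU : Turing.TM2ComputableAux Bool Bool),
    (∀ (N : ℕ) (x : List Bool) (b : Bool), x.length < N →
      MU.OutputsWithin (boolPair (encodeNat N) (boolPair (reach A N x) [b]))
        (reach A N (x ++ [b])) (T N)) →
    ∃ ML : Turing.TM2ComputableAux Bool Bool,
      ∀ (v : List Bool) (N n : ℕ), v.length = n + 1 →
        ML.OutputsWithin (orbit A v N 0) (orbit A v N (n + 1))
          (q.eval (v.length + S v.length + T v.length + (natE v.length).length
            + (natE N).length)) := by
  obtain ⟨pa, Ma, ha⟩ := cf_ra.polyTimeComputable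
  obtain ⟨pb, Mb, hb⟩ := cf_rb.polyTimeComputable
  refine ⟨X * (pa.comp (2 * X + 10) + pb.comp (2 * X + 10) + 20 * X + 60),
    fun A S T hS MU hU => ⟨TM2While.whileAux ((Ma.comp (mapFstAux MU)).comp Mb) (fun a : Bool => a),
      fun v N n hn => ?_⟩⟩
  set Q := v.length + S v.length + T v.length + (natE v.length).length + (natE N).length
    with hQ
  set R := pa.eval (2 * Q + 10) + pb.eval (2 * Q + 10) + 16 * Q + 38 with hR
  have hσ : ∀ i, (reach A v.length (v.take i)).length ≤ S v.length := fun i =>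
    hS v.length (v.take i) (by rw [List.length_take]; omega)
  have hol : ∀ i, (orbit A v N i).length ≤ 2 * Q + 10 := fun i => by
    rw [orbit, length_lwE]
    have h1 := hσ i
    have h2 : (v.drop i).length ≤ v.length := by rw [List.length_drop]; omega
    omega
  -- one round: stage a on codes, the update machine on the first field, stage b on codes
  have hround : ∀ i < v.length, ((Ma.comp (mapFstAux MU)).comp Mb).OutputsWithin
      (orbit A v N i) (orbit A v N (i + 1)) R := by
    intro i hi
    have hdrop : v.drop i = v[i] :: v.drop (i + 1) := List.drop_eq_getElem_cons hi
    have htake : v.take (i + 1) = v.take i ++ [v[i]] := List.take_succ_eq_append_getElem hi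
    have Ha : Ma.OutputsWithin (orbit A v N i)
        (pairE CStream.uE ctE ((v.length, reach A v.length (v.take i), (v.drop i).headD false),
          ((v.drop i).tail, v.length, N)))
        (pa.eval (orbit A v N i).length) :=
      ha (fl v i, reach A v.length (v.take i), v.drop i, v.length, N)
    rw [hdrop, List.headD_cons, List.tail_cons] at Ha
    have HU : MU.OutputsWithin
        (boolUnpair (pairE CStream.uE ctE ((v.length, reach A v.length (v.take i), v[i]),
          (v.drop (i + 1), v.length, N)))).1
        (reach A v.length (v.take (i + 1))) (T v.length) := by
      rw [pairE_apply, boolUnpair_boolPair, htake]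
      exact hU v.length (v.take i) v[i] (by rw [List.length_take]; omega)
    have Hm := outputsWithin_mapFstAux MU HU
    rw [show PairFstTM.readRest (pairE CStream.uE ctE ((v.length, reach A v.length (v.take i), v[i]),
        (v.drop (i + 1), v.length, N))) = ctE (v.drop (i + 1), v.length, N) by
      rw [pairE_apply, readRest_boolPair]] at Hm
    have Hb : Mb.OutputsWithin
        (boolPair (reach A v.length (v.take (i + 1))) (ctE (v.drop (i + 1), v.length, N)))
        (orbit A v N (i + 1))
        (pb.eval (boolPair (reach A v.length (v.take (i + 1)))
          (ctE (v.drop (i + 1), v.length, N))).length) :=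
      hb (reach A v.length (v.take (i + 1)), (v.drop (i + 1), v.length, N))
    have H := Turing.TM2ComputableAux.comp_outputsWithin _ _
      (Turing.TM2ComputableAux.comp_outputsWithin _ _ Ha Hm) Hb
    refine H.mono ?_
    have h1 := TM2Iter.eval_mono pa (hol i)
    have h2 := hσ (i + 1)
    have h3 : (v.drop (i + 1)).length ≤ v.length := by rw [List.length_drop]; omega
    have h4 := hσ i
    have hz : (pairE CStream.uE ctE ((v.length, reach A v.length (v.take i), v[i]),
        (v.drop (i + 1), v.length, N))).length ≤ 6 * Q + 16 := by
      simp only [pairE_apply, length_boolPair, bitE, List.length_singleton, strE, id]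
      omega
    have hy : (boolPair (reach A v.length (v.take (i + 1)))
        (ctE (v.drop (i + 1), v.length, N))).length ≤ 2 * Q + 10 := by
      simp only [pairE_apply, length_boolPair, strE, id]
      omega
    have h5 := TM2Iter.eval_mono pb hy
    omega
  -- the loop
  have hrun : ∀ i ≤ n, ((Ma.comp (mapFstAux MU)).comp Mb).OutputsWithin
      (orbit A v N i) (orbit A v N (i + 1)) R := fun i hi => hround i (by omega)
  have hgo : ∀ i < n, ∃ a rest, orbit A v N (i + 1) = a :: rest ∧ (fun a : Bool => a) a = false :=
    fun i hi => ⟨_, _, orbit_eq_cons A v N (i + 1), by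
      have : ¬ v.length ≤ i + 1 := by omega
      simpa [fl] using this⟩
  have hstop : ∃ a rest, orbit A v N (n + 1) = a :: rest ∧ (fun a : Bool => a) a = true :=
    ⟨_, _, orbit_eq_cons A v N (n + 1), by
      have : v.length ≤ n + 1 := by omega
      simpa [fl] using this⟩
  have HL := TM2While.whileAux_outputsWithin ((Ma.comp (mapFstAux MU)).comp Mb)
    (fun a : Bool => a) n (orbit A v N) (fun _ => R) hrun hgo hstop
  refine HL.mono ?_
  have hsum : ∑ i ∈ Finset.range (n + 1), (R + 2 * (orbit A v N (i + 1)).length + 2)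
      ≤ (n + 1) * (R + 4 * Q + 22) := by
    have h := Finset.sum_le_card_nsmul (Finset.range (n + 1))
      (fun i => R + 2 * (orbit A v N (i + 1)).length + 2) (R + 4 * Q + 22)
      (fun i _ => by have := hol (i + 1); omega)
    simpa using h
  have hq : (X * (pa.comp (2 * X + 10) + pb.comp (2 * X + 10) + 20 * X + 60) : Polynomial ℕ).eval Q
      = Q * (R + 4 * Q + 22) := by
    rw [hR]
    simp only [eval_mul, eval_add, eval_comp, eval_X, eval_ofNat]
    ring
  rw [hq]
  exact hsum.trans (Nat.mul_le_mul_right _ (by omega))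

/-- **The decider, universal polynomial.** There is ONE polynomial `p` such that EVERY uniform
streaming algorithm with empty initial states, space `S` and uniform update and report time `T`
is simulated by one `TM2` machine that outputs `[A.accept |w| (A.finalState w)]` on every input `w`
within `p(|w| + S |v| + T |v| + T |w|)` steps (`v` the effective input). (Proof text of
`exists_streamDecider`; `p` is built from `exists_loopPoly` and the code stages `cf_pre`, `cf_post`.)
[cite: AroraBarak2009, §1.3–1.4 (composition of machines; loops)] -/
theorem exists_deciderPoly : ∃ p : Polynomial ℕ, ∀ (A : StreamingAlgorithm),
    (∀ N, A.init N = []) → ∀ (S T : ℕ → ℕ), RunsInSpace A S → HasUniformUpdateTime A T →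
    HasUniformReportTime A T →
    ∃ M : Turing.TM2ComputableAux Bool Bool, ∀ w : List Bool,
      M.OutputsWithin w [A.accept w.length (A.finalState w)]
        (p.eval (w.length + S (eff w).length + T (eff w).length + T w.length)) := by
  obtain ⟨q, hq⟩ := exists_loopPoly
  obtain ⟨pp, Mp, hp⟩ := cf_pre.polyTimeComputable
  obtain ⟨pc, Mc, hc⟩ := cf_post.polyTimeComputable
  refine ⟨pp + q.comp (3 * X + 2) + pc.comp (5 * X + 12) + X, fun A h0 S T hS hU hR => ?_⟩
  obtain ⟨MU, hMU⟩ := hU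
  obtain ⟨MR, hMR⟩ := hR
  obtain ⟨ML, hL⟩ := hq A S T hS MU hMU
  refine ⟨((Mp.comp ML).comp Mc).comp MR, fun w => ?_⟩
  obtain ⟨n, hn⟩ : ∃ n, (eff w).length = n + 1 :=
    ⟨(eff w).length - 1, by have := List.length_pos_iff.mpr (eff_ne_nil w); omega⟩
  -- stage 1: the initial loop word
  have e0 : orbit A (eff w) w.length 0 = lwE (false, [], eff w, (eff w).length, w.length) := by
    simp only [orbit, fl, List.take_zero, List.drop_zero, reach_nil, h0]
  have H1 : Mp.OutputsWithin w (orbit A (eff w) w.length 0) (pp.eval w.length) := by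
    rw [e0]; exact hp w
  -- stage 2: the loop
  have H2 := hL (eff w) w.length n hn
  -- stage 3: extract `⟨N, final state⟩`
  have hfin : (if w.length = 0 then [] else reach A (eff w).length ((eff w).take (n + 1)))
      = A.finalState w := by
    by_cases hw : w = []
    · subst hw; simp [finalState_eq_reach, h0]
    · have hn' : w.length = n + 1 := by rw [eff_of_ne_nil hw] at hn; exact hn
      rw [if_neg (by rw [List.length_eq_zero_iff]; exact hw), eff_of_ne_nil hw,
        finalState_eq_reach, List.take_of_length_le (by omega)]
  have H3 : Mc.OutputsWithin (orbit A (eff w) w.length (n + 1))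
      (pairE natE strE (w.length,
        if w.length = 0 then [] else reach A (eff w).length ((eff w).take (n + 1))))
      (pc.eval (orbit A (eff w) w.length (n + 1)).length) :=
    hc (fl (eff w) (n + 1), reach A (eff w).length ((eff w).take (n + 1)),
      (eff w).drop (n + 1), (eff w).length, w.length)
  rw [hfin] at H3
  -- stage 4: report
  have H4 : MR.OutputsWithin (pairE natE strE (w.length, A.finalState w))
      [A.accept w.length (A.finalState w)] (T w.length) := hMR w
  have H := Turing.TM2ComputableAux.comp_outputsWithin _ _
    (Turing.TM2ComputableAux.comp_outputsWithin _ _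
      (Turing.TM2ComputableAux.comp_outputsWithin _ _ H1 H2) H3) H4
  refine H.mono ?_
  -- the time bound
  set U := w.length + S (eff w).length + T (eff w).length + T w.length with hUdef
  have hv : (eff w).length ≤ w.length + 1 := by rw [length_eff]; omega
  have hn1 := length_natE_le (eff w).length
  have hn2 := length_natE_le w.length
  have hQ : (eff w).length + S (eff w).length + T (eff w).length + (natE (eff w).length).length
      + (natE w.length).length ≤ 3 * U + 2 := by omega
  have hlast : (orbit A (eff w) w.length (n + 1)).length ≤ 5 * U + 12 := by
    rw [orbit, length_lwE]
    have h1 : (reach A (eff w).length ((eff w).take (n + 1))).length ≤ S (eff w).length :=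
      hS _ _ (by rw [List.length_take]; omega)
    have h2 : ((eff w).drop (n + 1)).length = 0 := by rw [List.length_drop]; omega
    omega
  have e : (pp + q.comp (3 * X + 2) + pc.comp (5 * X + 12) + X : Polynomial ℕ).eval U
      = pp.eval U + q.eval (3 * U + 2) + pc.eval (5 * U + 12) + U := by
    simp only [eval_add, eval_comp, eval_mul, eval_X, eval_ofNat]
  rw [e]
  have e1 := TM2Iter.eval_mono pp (show w.length ≤ U by omega)
  have e2 := TM2Iter.eval_mono q hQ
  have e3 := TM2Iter.eval_mono pc hlast
  omega

end USim

/-! ### THEOREM D♯: one exponent per level -/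

/-- **THEOREM D♯ (`USTREAM(Nᵏ+k) ⊆ DTIME(nᵈ)` for one `d = d(k)`).** For every `k` there is an
exponent `d` such that every language decided by a uniform one-pass streaming algorithm with empty
initial states, space `S N ≤ Nᵏ + k` and update / report time `T N ≤ Nᵏ + k` lies in `DTIME(nᵈ)`.
The exponent is universal (it depends on `k` and on the tree's fixed code stages only) but is not
computed here. [cite: McKayMurrayWilliams2019, §2 (the streaming model)] [cite: AroraBarak2009, Def. 1.12–1.13] -/
theorem exists_USTREAM_subset_DTIME_pow (k : ℕ) : ∃ d : ℕ, ∀ (S T : ℕ → ℕ),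
    (∀ N, S N ≤ N ^ k + k) → (∀ N, T N ≤ N ^ k + k) → USTREAM S T ⊆ DTIME (fun n => n ^ d) := by
  obtain ⟨p, hp⟩ := USim.exists_deciderPoly
  obtain ⟨c, d, hcd⟩ := exists_eval_le_mul_pow_add (p.comp (X + 3 * ((X + 1) ^ k + C k)))
  refine ⟨d, fun S T hSk hTk => ?_⟩
  rintro L ⟨A, h0, hS, hU, hR, hD⟩
  obtain ⟨M, hM⟩ := hp A h0 S T hS hU hR
  refine ⟨c, M, fun w => ?_⟩
  have hacc : A.accept w.length (A.finalState w) = L.boolIndicator w := by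
    rw [Bool.eq_iff_iff, ← Set.mem_iff_boolIndicator]
    exact hD w
  have h := hM w
  rw [hacc] at h
  refine h.mono (le_trans ?_ (hcd w.length))
  have e : (p.comp (X + 3 * ((X + 1) ^ k + C k))).eval w.length
      = p.eval (w.length + 3 * ((w.length + 1) ^ k + k)) := by
    simp only [eval_comp, eval_add, eval_mul, eval_pow, eval_X, eval_C, eval_one, eval_ofNat]
  rw [e]
  have hv : (USim.eff w).length ≤ w.length + 1 := by rw [USim.length_eff]; omega
  have h1 : (USim.eff w).length ^ k ≤ (w.length + 1) ^ k := Nat.pow_le_pow_left hv k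
  have h2 : w.length ^ k ≤ (w.length + 1) ^ k := Nat.pow_le_pow_left (Nat.le_succ _) k
  have h3 := hSk (USim.eff w).length
  have h4 := hTk (USim.eff w).length
  have h5 := hTk w.length
  exact TM2Iter.eval_mono p (by omega)

end Summit.PneNP.PneNP.Theorems.SoloBlind
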